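import Summits.FinalStateConjecture.FinalStateConjecture.Theorems.BondiDrainDispersalHorizonlessMustDrainTrivialDatumFibre
import Summits.FinalStateConjecture.FinalStateConjecture.Theorems.BondiDrainDispersalHorizonlessMustDrainMinkowskiNoHorizon
import Summits.FinalStateConjecture.FinalStateConjecture.Theorems.BondiDrainDispersalHorizonlessMustDrainNoHorizonTransport
import Summits.FinalStateConjecture.FinalStateConjecture.Theorems.PhaseMixingCaptureWeakCosmicCensorshipMGHDCompleteNullInfinityInvariant
import HarnessLib

/-!
# `HorizonlessMustDrain` is non-vacuously true on the fibre over the trivial datum (hypotheses included)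

Wave 2 of the sanity tier of line `registered` of the crux `Theses.BondiDrainDispersal.HorizonlessMustDrain` (item
stmt-FinalStateConjecture-9976, route BondiDrainDispersal; lead c2, 2026-08-17).  `TrivialDatumFibre.lean` (p151622) proved the
crux's CONCLUSION — vanishing final Bondi mass — for every maximal vacuum Cauchy development of `(ℝ³, δ, 0)`, with the crux's two
hypotheses idle.  Here the hypotheses are discharged on that fibre as well:

* `stub_trivialDatumFibreFull` (registered glue stub) — **every maximal vacuum Cauchy development `𝒟` of the trivial datum has
  complete future null infinity (sojourn form), has no event horizon in the ray-theoretic sense of the crux, and has vanishing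
  final Bondi mass.**  Complete `𝓘⁺` of Minkowski space (`Minkowski.hasCompleteFutureNullInfinity_vacuumCauchyDevelopment`,
  KissingBallsCutMass.lean) and its invariance under isometry of developments
  (`…WeakCosmicCensorshipMGHD.hasCompleteNullInfinity_iff_of_isIsometricTo`); no horizon of Minkowski space
  (`stub_minkowskiNoHorizon`, p152194) and its invariance (`stub_noHorizon_transport`, p152109); vanishing final Bondi mass
  (`stub_trivialDatumFibre`, p151622); all moved along `Minkowski.isIsometricTo_vacuumCauchyDevelopment_of_isMaximal`.
* `horizonlessMustDrain_instance_of_isMaximal` — the same, displayed as "hypotheses ∧ conclusion" of the crux at `(ℝ³, δ, 0)`: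
  the crux is consistent and non-vacuous in its exact typing; a counterexample needs a non-flat admissible datum.
* `exists_horizonlessMustDrain_instance` — under the Choquet-Bruhat–Geroch existence theorem (the named fact
  `choquetBruhat_geroch_exists_mghd_cauchy`, through `Minkowski.isMaximal_vacuumCauchyDevelopment`) such a development EXISTS,
  namely Minkowski space itself: an admissible datum and an MGHD instantiating hypotheses and conclusion together.

Everything is proved; no definition, no named fact introduced (the last item takes the existing named fact as a hypothesis).

## References

* R. M. Wald, *General Relativity* (1984), §12.1, p. 300 (in Minkowski space `I⁻(𝓘⁺)` is everything). [Wald1984GR]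
* D. Christodoulou, CQG 16 (1999) A23, pp. A26–A27 (complete `𝓘⁺`, Minkowski space). [Christodoulou1999]
* D. Christodoulou, S. Klainerman, Princeton 1993, Ch. 17 (`M ≡ 0` for Minkowski space). [ChristodoulouKlainerman1993]
* Y. Choquet-Bruhat, R. Geroch, Comm. Math. Phys. 14 (1969), Thm. 3. [ChoquetBruhatGeroch1969CMP]
-/

set_option linter.dupNamespace false

noncomputable section

open scoped Manifold ContDiff Topology
open Set Function Literature.Geometry.Lorentzian

namespace Summit.FinalStateConjecture.FinalStateConjecture.Theorems.BondiDrainDispersalHorizonlessMustDrain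

open Literature.Geometry.Lorentzian.Minkowski
open Summit.FinalStateConjecture.FinalStateConjecture.Theorems.PhaseMixingCapture.WeakCosmicCensorshipMGHD
  (hasCompleteNullInfinity_iff_of_isIsometricTo)

/-- **THE CRUX HOLDS, HYPOTHESES INCLUDED, ON THE WHOLE FIBRE OVER THE TRIVIAL DATUM** (registered glue stub of line
`registered`, crux stmt-FinalStateConjecture-9976): every maximal vacuum Cauchy development `𝒟` of `(ℝ³, δ, 0)` has complete
future null infinity (sojourn form, `Summit.FinalStateConjecture.HasCompleteNullInfinity`), has NO event horizon in the
ray-theoretic sense of `HorizonlessMustDrain` (it is false that some event lies outside `I⁻(γ(dom ∩ [0, ∞)))` of every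
future-complete normalised null ray `γ` from the data hypersurface), AND has vanishing final Bondi mass.  Transport along the
development isometry `Minkowski.isIsometricTo_vacuumCauchyDevelopment_of_isMaximal` of the three Minkowski facts
(`hasCompleteFutureNullInfinity_vacuumCauchyDevelopment`; `stub_minkowskiNoHorizon`; `stub_minkowskiVanishingFinalBondiMass`) by
`hasCompleteNullInfinity_iff_of_isIsometricTo`, `stub_noHorizon_transport`, `stub_hasVanishingFinalBondiMass_transport`.
[cite: Wald1984GR, §12.1, p. 300] -/
theorem stub_trivialDatumFibreFull :
    ∀ 𝒟 : Literature.Geometry.Lorentzian.VacuumCauchyDevelopment Literature.Geometry.Lorentzian.trivialData, 𝒟.IsMaximal →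
      Summit.FinalStateConjecture.HasCompleteNullInfinity 𝒟.toCauchyDevelopment ∧
      ¬ (∀ [𝒟.metric.HasLeviCivita], ∃ q : 𝒟.carrier, ∀ (p : Literature.Geometry.Lorentzian.Minkowski.slice) (γ : ℝ → 𝒟.carrier) (dom : Set ℝ),
          𝒟.metric.IsNormalisedNullRayFrom 𝒟.timeOrientation 𝒟.embed 𝒟.normal p γ dom → ¬ BddAbove dom →
            q ∉ 𝒟.metric.chronologicalPast 𝒟.timeOrientation (γ '' (dom ∩ Set.Ici 0))) ∧
      𝒟.toCauchyDevelopment.HasVanishingFinalBondiMass := by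
  intro 𝒟 hmax
  have hiso := Minkowski.isIsometricTo_vacuumCauchyDevelopment_of_isMaximal hmax
  have hscri : Summit.FinalStateConjecture.HasCompleteNullInfinity 𝒟.toCauchyDevelopment :=
    (hasCompleteNullInfinity_iff_of_isIsometricTo _ _ hiso).1
      (fun {_} ↦ hasCompleteFutureNullInfinity_vacuumCauchyDevelopment)
  have hH := stub_noHorizon_transport _ _ hiso stub_minkowskiNoHorizon
  exact ⟨hscri, hH, stub_trivialDatumFibre 𝒟 hmax hscri hH⟩

/-- **Hypotheses and conclusion of `HorizonlessMustDrain` hold together at every MGHD of the trivial datum**: the datum is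
admissible, the development is maximal (given), it has complete `𝓘⁺` and no event horizon, and its final Bondi mass vanishes —
the body of the crux at `(X, D) = (ℝ³, (δ, 0))` with no hypothesis idle.  Consistency / anti-vacuity certificate for the
refuter's vetting; it does not close the item (open problem for general data). [cite: ChristodoulouKlainerman1993, Ch. 17] -/
theorem horizonlessMustDrain_instance_of_isMaximal (𝒟 : VacuumCauchyDevelopment trivialData) (hmax : 𝒟.IsMaximal) :
    trivialData ∈ admissibleVacuumData Minkowski.slice ∧ 𝒟.IsMaximal ∧
      Summit.FinalStateConjecture.HasCompleteNullInfinity 𝒟.toCauchyDevelopment ∧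
      ¬ (∀ [𝒟.metric.HasLeviCivita], ∃ q : 𝒟.carrier, ∀ (p : Minkowski.slice) (γ : ℝ → 𝒟.carrier) (dom : Set ℝ),
          𝒟.metric.IsNormalisedNullRayFrom 𝒟.timeOrientation 𝒟.embed 𝒟.normal p γ dom → ¬ BddAbove dom →
            q ∉ 𝒟.metric.chronologicalPast 𝒟.timeOrientation (γ '' (dom ∩ Set.Ici 0))) ∧
      𝒟.toCauchyDevelopment.HasVanishingFinalBondiMass :=
  ⟨trivialData_mem_admissibleVacuumData, hmax, stub_trivialDatumFibreFull 𝒟 hmax⟩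

/-- **Under the Choquet-Bruhat–Geroch theorem the instance EXISTS**: granted MGHD existence (the named fact
`choquetBruhat_geroch_exists_mghd_cauchy`, `CauchyProblemMGHDExistence.lean`), Minkowski space is a maximal vacuum Cauchy
development of the admissible trivial datum (`Minkowski.isMaximal_vacuumCauchyDevelopment`) at which complete `𝓘⁺`, no event
horizon and vanishing final Bondi mass hold together. [cite: ChoquetBruhatGeroch1969CMP, Thm. 3 (p. 332)] -/
theorem exists_horizonlessMustDrain_instance (hcbg : choquetBruhat_geroch_exists_mghd_cauchy) :
    ∃ 𝒟 : VacuumCauchyDevelopment trivialData,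
      trivialData ∈ admissibleVacuumData Minkowski.slice ∧ 𝒟.IsMaximal ∧
        Summit.FinalStateConjecture.HasCompleteNullInfinity 𝒟.toCauchyDevelopment ∧
        ¬ (∀ [𝒟.metric.HasLeviCivita], ∃ q : 𝒟.carrier, ∀ (p : Minkowski.slice) (γ : ℝ → 𝒟.carrier) (dom : Set ℝ),
            𝒟.metric.IsNormalisedNullRayFrom 𝒟.timeOrientation 𝒟.embed 𝒟.normal p γ dom → ¬ BddAbove dom →
              q ∉ 𝒟.metric.chronologicalPast 𝒟.timeOrientation (γ '' (dom ∩ Set.Ici 0))) ∧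
        𝒟.toCauchyDevelopment.HasVanishingFinalBondiMass :=
  ⟨vacuumCauchyDevelopment,
    horizonlessMustDrain_instance_of_isMaximal _ (Minkowski.isMaximal_vacuumCauchyDevelopment hcbg)⟩

end Summit.FinalStateConjecture.FinalStateConjecture.Theorems.BondiDrainDispersalHorizonlessMustDrain

end
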